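import Mathlib
import HarnessLib
import Summits.HubbardSuperconductivity.HubbardSuperconductivity.Theorems.KLProgrammeKLRegimeVolumeLimitTwoTimeReindex

/-!
# Child `KLRegimeVolumeLimitV14` (stmt-HubbardSuperconductivity-19921), `stub_vl_bound` via (H1), C2 step (a): the split-pair matrix of the
# two-time block letter data IS k3c5-p1's `twoTimeHamMatrix` of the APPEND-form pair data, and the `Fin`-cast `2k+2j = (k+j)·2`
# (seat hubbard-kl-k3c5-p2, g4; technique «analytic-continuation-free assembly via FinalTwoLegVolLimit»)

* `twoTimeCast_divNat_castAdd/_modNat_castAdd/_divNat_natAdd/_modNat_natAdd` — pair index (vertex, spin) of the two blocks under the cast;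
* `det_twoTimeLimitMatrix_comp_cast` — `det twoTimeLimitMatrix` is invariant under re-indexing the pair data along `Fin.cast` (a `subst`);
* `twoTime_pairSite/_pairSpin/_pairTime_append_eq_cast` — the APPEND-form pair data (sites `x_{a(m)}`, spins `m % 2`, Grassmann times
  `β(1−u) ⧺ (s−βu′)`) are the vertex data read through the cast (`w = u ⧺ ((β−s)/β + u′)`, `t = β(1 − w_{a(m)})`);
* **`twoTimeHamMatrix_append_eq_splitPairMatrix`** — `splitPairMatrix β h (2k) (2k+2j)` of the block letter data of k3c5-p1's
  `gibbsState_dGamma_twoTime_shiftedHubbardWord_eq_neg_det` (p490677; pair times `−βu_i`, `−β((β−s)/β+u′_l)`, inserted creation at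
  `−β(β−s)/β`, leading annihilation at `0`) = `twoTimeHamMatrix β μ (2k)` (p492846) of the append-form pair data, via
  `append_cons_eq_insertNth` (p493232).
Used by `…VolumeLimitTwoPointC2` (C2 as a theorem).  Everything is proved; no definition.
-/

noncomputable section

namespace Summit.HubbardSuperconductivity.HubbardSuperconductivity.Theorems.TwoPointAssembly

set_option linter.dupNamespace false -- summit = problem name (single-conjunct summit), D-0017

open Finset NormedSpace Matrix Literature.MathematicalPhysics.QuantumLattice Literature.Probability.LatticeModels
open scoped ComplexOrder

variable {L : ℕ} [NeZero L]

section Index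

/-- Pair index of the first block under the cast `2k+2j = (k+j)·2`: vertex `a/2` (`castAdd`). -/
theorem twoTimeCast_divNat_castAdd {k j : ℕ} (h : k * 2 + j * 2 = (k + j) * 2) (a : Fin (k * 2)) :
    (Fin.cast h (Fin.castAdd (j * 2) a)).divNat = Fin.castAdd j a.divNat := by
  ext; simp

/-- Pair index of the first block under the cast: spin `a % 2`. -/
theorem twoTimeCast_modNat_castAdd {k j : ℕ} (h : k * 2 + j * 2 = (k + j) * 2) (a : Fin (k * 2)) :
    (Fin.cast h (Fin.castAdd (j * 2) a)).modNat = a.modNat := by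
  ext; simp

/-- Pair index of the second block under the cast: vertex `k + b/2` (`natAdd`). -/
theorem twoTimeCast_divNat_natAdd {k j : ℕ} (h : k * 2 + j * 2 = (k + j) * 2) (b : Fin (j * 2)) :
    (Fin.cast h (Fin.natAdd (k * 2) b)).divNat = Fin.natAdd k b.divNat := by
  ext; simp; omega

/-- Pair index of the second block under the cast: spin `b % 2`. -/
theorem twoTimeCast_modNat_natAdd {k j : ℕ} (h : k * 2 + j * 2 = (k + j) * 2) (b : Fin (j * 2)) :
    (Fin.cast h (Fin.natAdd (k * 2) b)).modNat = b.modNat := by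
  ext; simp

/-- `det twoTimeLimitMatrix` is invariant under re-indexing the pair data along a `Fin.cast`. -/
theorem det_twoTimeLimitMatrix_comp_cast (β μ : ℝ) {N₁ N₂ : ℕ} (h : N₁ = N₂) (y : Fin N₂ → TorusSite 2 L) (ς : Fin N₂ → Fin 2)
    (t : Fin N₂ → ℝ) (xe ye : TorusSite 2 L) (σ σ' : Fin 2) (s : ℝ) :
    (twoTimeLimitMatrix β μ (fun m => y (Fin.cast h m)) (fun m => ς (Fin.cast h m)) (fun m => t (Fin.cast h m)) xe ye σ σ' s).det =
      (twoTimeLimitMatrix β μ y ς t xe ye σ σ' s).det := by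
  subst h; rfl

omit [NeZero L] in
/-- The APPEND-form pair sites are the vertex sites `x_{a(m)}` read through the cast. -/
theorem twoTime_pairSite_append_eq_cast {k j : ℕ} (h : k * 2 + j * 2 = (k + j) * 2) (f : Fin k → FermionTorus 2 L)
    (f' : Fin j → FermionTorus 2 L) :
    (Fin.append (fun m : Fin (k * 2) => FermionTorus.toTorusSite (f (finProdFinEquiv.symm m).1))
          (fun m : Fin (j * 2) => FermionTorus.toTorusSite (f' (finProdFinEquiv.symm m).1)) : Fin (k * 2 + j * 2) → TorusSite 2 L) =
      (fun m : Fin (k * 2 + j * 2) => FermionTorus.toTorusSite (Fin.append f f' (finProdFinEquiv.symm (Fin.cast h m) : Fin (k + j) × Fin 2).1)) := by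
  funext m
  induction m using Fin.addCases with
  | left a => simp only [Fin.append_left, finProdFinEquiv_symm_apply, twoTimeCast_divNat_castAdd h]
  | right b => simp only [Fin.append_right, finProdFinEquiv_symm_apply, twoTimeCast_divNat_natAdd h]

/-- The APPEND-form pair spins are `m % 2` read through the cast. -/
theorem twoTime_pairSpin_append_eq_cast {k j : ℕ} (h : k * 2 + j * 2 = (k + j) * 2) :
    (Fin.append (fun m : Fin (k * 2) => (finProdFinEquiv.symm m).2) (fun m : Fin (j * 2) => (finProdFinEquiv.symm m).2) :
          Fin (k * 2 + j * 2) → Fin 2) =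
      (fun m : Fin (k * 2 + j * 2) => (finProdFinEquiv.symm (Fin.cast h m) : Fin (k + j) × Fin 2).2) := by
  funext m
  induction m using Fin.addCases with
  | left a => simp only [Fin.append_left, finProdFinEquiv_symm_apply, twoTimeCast_modNat_castAdd h]
  | right b => simp only [Fin.append_right, finProdFinEquiv_symm_apply, twoTimeCast_modNat_natAdd h]

/-- The APPEND-form Grassmann pair times `β(1−u) ⧺ (s−βu′)` are `β(1 − w_{a(m)})`, `w = u ⧺ ((β−s)/β + u′)`, read through the cast. -/
theorem twoTime_pairTime_append_eq_cast {k j : ℕ} (h : k * 2 + j * 2 = (k + j) * 2) (β s : ℝ) (u : Fin k → ℝ) (u' : Fin j → ℝ) :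
    (Fin.append (fun m : Fin (k * 2) => β * (1 - u (finProdFinEquiv.symm m).1))
          (fun m : Fin (j * 2) => β * (1 - ((β - s) / β + u' (finProdFinEquiv.symm m).1))) : Fin (k * 2 + j * 2) → ℝ) =
      (fun m : Fin (k * 2 + j * 2) => β * (1 - Fin.append u (fun l => (β - s) / β + u' l) (finProdFinEquiv.symm (Fin.cast h m) : Fin (k + j) × Fin 2).1)) := by
  funext m
  induction m using Fin.addCases with
  | left a => simp only [Fin.append_left, finProdFinEquiv_symm_apply, twoTimeCast_divNat_castAdd h]
  | right b => simp only [Fin.append_right, finProdFinEquiv_symm_apply, twoTimeCast_divNat_natAdd h]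

end Index

section HamMatrix

/-- **`Msplit` is `twoTimeHamMatrix` of the append-form pair data.**  The split-pair matrix of the block letter data of
`gibbsState_dGamma_twoTime_shiftedHubbardWord_eq_neg_det` (pair times `−βu_i`, `−β((β−s)/β+u′_l)`, inserted creation at `−β(β−s)/β`,
leading annihilation at `0`) on the Hubbard torus equals k3c5-p1's `twoTimeHamMatrix β μ (2k)` with sites `x_{a(m)}`, spins `m % 2` and
Grassmann times `β(1−u) ⧺ (s−βu′)` (`β ≠ 0`). -/
theorem twoTimeHamMatrix_append_eq_splitPairMatrix {β : ℝ} (hβ : β ≠ 0) (μ : ℝ) (σ σ' : Fin 2) (xe ye : TorusSite 2 L) (s : ℝ) {k j : ℕ}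
    (f : Fin k → FermionTorus 2 L) (f' : Fin j → FermionTorus 2 L) (u : Fin k → ℝ) (u' : Fin j → ℝ) :
    twoTimeHamMatrix β μ (k * 2) (Nat.le_add_right (k * 2) (j * 2))
        (Fin.append (fun m : Fin (k * 2) => FermionTorus.toTorusSite (f (finProdFinEquiv.symm m).1))
          (fun m : Fin (j * 2) => FermionTorus.toTorusSite (f' (finProdFinEquiv.symm m).1)) : Fin (k * 2 + j * 2) → TorusSite 2 L)
        (Fin.append (fun m : Fin (k * 2) => (finProdFinEquiv.symm m).2) (fun m : Fin (j * 2) => (finProdFinEquiv.symm m).2) :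
          Fin (k * 2 + j * 2) → Fin 2)
        (Fin.append (fun m : Fin (k * 2) => β * (1 - u (finProdFinEquiv.symm m).1))
          (fun m : Fin (j * 2) => β * (1 - ((β - s) / β + u' (finProdFinEquiv.symm m).1))) : Fin (k * 2 + j * 2) → ℝ) xe ye σ σ' s =
      splitPairMatrix β (hubbardOneBody (fermionTorusGraph 2 L) 1 μ) (k * 2) (k * 2 + j * 2) (Nat.le_add_right (k * 2) (j * 2))
        (Fin.append (m := k * 2) (n := j * 2 + 1)
          (fun m : Fin (k * 2) => creVec (hubbardOneBody (fermionTorusGraph 2 L) 1 μ) ((((u (finProdFinEquiv.symm m).1 : ℝ) : ℂ)) * -(β : ℂ))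
            (orb (f (finProdFinEquiv.symm m).1) (finProdFinEquiv.symm m).2))
          (Fin.cons (creVec (hubbardOneBody (fermionTorusGraph 2 L) 1 μ) ((((β - s) / β : ℝ) : ℂ) * -(β : ℂ)) (orb (FermionTorus.ofTorusSite xe) σ))
            (fun m : Fin (j * 2) => creVec (hubbardOneBody (fermionTorusGraph 2 L) 1 μ) (((((β - s) / β + u' (finProdFinEquiv.symm m).1 : ℝ) : ℂ)) * -(β : ℂ))
              (orb (f' (finProdFinEquiv.symm m).1) (finProdFinEquiv.symm m).2)) :
            Fin (j * 2 + 1) → Orb (FermionTorus 2 L) → ℂ) : Fin (k * 2 + j * 2 + 1) → Orb (FermionTorus 2 L) → ℂ)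
        (Fin.cons (annVec (hubbardOneBody (fermionTorusGraph 2 L) 1 μ) 0 (orb (FermionTorus.ofTorusSite ye) σ'))
          (Fin.append
            (fun m : Fin (k * 2) => annVec (hubbardOneBody (fermionTorusGraph 2 L) 1 μ) ((((u (finProdFinEquiv.symm m).1 : ℝ) : ℂ)) * -(β : ℂ))
              (orb (f (finProdFinEquiv.symm m).1) (finProdFinEquiv.symm m).2))
            (fun m : Fin (j * 2) => annVec (hubbardOneBody (fermionTorusGraph 2 L) 1 μ) (((((β - s) / β + u' (finProdFinEquiv.symm m).1 : ℝ) : ℂ)) * -(β : ℂ))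
              (orb (f' (finProdFinEquiv.symm m).1) (finProdFinEquiv.symm m).2))) :
          Fin (k * 2 + j * 2 + 1) → Orb (FermionTorus 2 L) → ℂ) := by
  have hβC : (β : ℂ) ≠ 0 := by exact_mod_cast hβ
  unfold twoTimeHamMatrix
  congr 1
  · rw [append_cons_eq_insertNth]
    funext i
    refine Fin.succAboveCases (⟨k * 2, Nat.lt_succ_of_le (Nat.le_add_right (k * 2) (j * 2))⟩ : Fin (k * 2 + j * 2 + 1)) ?_ (fun m => ?_) i
    · simp only [Fin.insertNth_apply_same]
      congr 1
      push_cast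
      field_simp
      ring
    · simp only [Fin.insertNth_apply_succAbove]
      induction m using Fin.addCases with
      | left a =>
        simp only [Fin.append_left, FermionTorus.ofTorusSite_toTorusSite]
        congr 1
        push_cast
        ring
      | right b =>
        simp only [Fin.append_right, FermionTorus.ofTorusSite_toTorusSite]
        congr 1
        push_cast
        ring
  · funext b
    refine Fin.cases ?_ (fun m => ?_) b
    · simp only [Fin.cons_zero]
    · simp only [Fin.cons_succ]
      induction m using Fin.addCases with
      | left a =>
        simp only [Fin.append_left, FermionTorus.ofTorusSite_toTorusSite]
        congr 1
        push_cast
        ring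
      | right b =>
        simp only [Fin.append_right, FermionTorus.ofTorusSite_toTorusSite]
        congr 1
        push_cast
        ring

end HamMatrix

end Summit.HubbardSuperconductivity.HubbardSuperconductivity.Theorems.TwoPointAssembly

end
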